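import Summits.CriticalPhenomena.SAWScalingLimit.Theses.SAWSpinMonotone
import Literature.Probability.Percolation.TriApproxDomain

/-!
# Birth skeleton (BC3) for the crux `SAWSpinMonotone.DressingTransfer`
(crux item stmt-CriticalPhenomena-16771, rank 4 of `route-CriticalPhenomena-SAWSpinMonotone`, sub-problem
`SAWScalingLimit`; skeleton registrar planner-skel-stmt-CriticalPhenomena-16771-0, 2026-08-17; tree path
`Summits/CriticalPhenomena/SAWScalingLimit/Cruxes/DressingTransfer/Lines/birth.lean`.)

Crux (FIXED, by name): `DressingTransfer := SpinMonotone → ArrivalFlattening → (K) ∧ (M)` — from (FM) spin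
monotonicity and (WCLT) bulk flattening of the FIRST-ARRIVAL winding transforms
`G_s(v) = Σ_{i} F_{Λ∖v}(a, {v,wᵢ}; x_c, s)` deduce the no-fold bound (K) `‖F{v,w₀} + ωF{v,w₁} + ω²F{v,w₂}‖ ≤
k‖ΣF‖`, `k < 1`, and the interior flattening (M) (`≤ ε‖ΣF‖` at depth `R(ε)`) of the FULL observable
`F = F_Λ(a, ·; x_c, 5/8)` (the texts of `SAWDevelopingMap.NoFoldBound` / `InteriorFlattening`).

## The line: DCS grouping read mode by mode — identities · source · domination · dressed flattening (4 stubs)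

This is the route header's own foreseen split ("TWO-LAYER PLAN … DressingTransfer ⇐ ModeIdentities ((I1),(I2):
provable-now lattice combinatorics of DCS's grouping) → DressingDecorrelation (L_γ asymptotically independent of the
far winding; LoopDressingBound promoted) → DressingTransfer"), TYPED, with the decorrelation half cut into the two
inequalities the assembly actually consumes and the source vertex (where (FM)/(WCLT) are vacuous) named separately.
Every walk of `Λ` from `a` to a port `{v,wᵢ}` of a vertex `v ∉ a` is a first arrival `γ` (a walk of `Λ∖v` from `a` to
a port `{v,wⱼ}`) followed by NOTHING, by ONE STEP through `v` (turn `±π/3`, weight `x_c`), or by a step through `v`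
and a RETURNING LOOP `η` of `(Λ∖v)∖γ` between the two other ports (extra winding `±4π/3`, weight
`L_γ = x_c Σ_η x_c^{ℓ(η)}` each way, equal by reversal) — Duminil-Copin–Smirnov's pair/triple grouping
(arXiv:1007.0575, proof of Lemma 1; tree fact `SAW.DuminilCopinSmirnov2012_lemma1`).  Summing with the three
`ℤ/3`-characters of the ports gives, at `σ = 5/8`:

* (A) `stub_modeIdentities` — `ModeIdentities` (M–L; PROVABLE NOW, finite combinatorics + polyline winding): for
  `v ∉ a`, (I1) `ΣF = α_T·G_{5/8} − √3·D_{5/8}` EXACTLY, and (I2) `‖F₀ + ωF₁ + ω²F₂‖ ≤ ‖β_T·G_{11/8} + √3·D_{11/8}‖`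
  (equality for one orientation of the labelling, `0` for the other by DCS Lemma 1; `|e^{-3iW}| = const` turns the
  spin-13/8 reading into the spin-11/8 one), where `α_T = 1 + 2x_c cos(5π/24)`, `β_T = 1 + 2x_c cos(11π/24)` and
  `D_s = Σ_γ e^{-isW(γ)} x_c^{ℓ(γ)} L_γ` is the LOOP-DRESSED first-arrival transform (`dressedTransform`).
* (S) `stub_sourceNoFold` — `SourceNoFold` (L; open, numerically wide margin): (K) at the source vertex `v ∈ a`,
  where `G_s ≡ 0` and (FM)/(WCLT) say nothing: `∃ k < 1`, `‖B‖ ≤ k‖ΣF‖` there.  By the exact source law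
  (`ΣF = α_T − √3L`, `‖B‖ ∈ {0, β_T + √3L}`, `L = x_c·Z`) this is EQUIVALENT to the sibling support item
  `SAWDevelopingMap.SourceLoopBound` (stmt-CriticalPhenomena-8300: `Z < c < sin(π/8)`; observed `Z ≤ 0.081`).
* (D) `stub_dressingDomination` — `DressingDomination` (L–XL; OPEN — the crux's own risk, "coherent dressing"):
  `∃ 0 ≤ λ < x_c sin(π/8)` with `‖D_{5/8}‖ ≤ λ‖G_{5/8}‖` and `‖D_{11/8}‖ ≤ λ‖G_{5/8}‖` uniformly (`v ∉ a`): the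
  returning-loop dressing (`L_γ ≤ L_max`, support `LoopDressingBound`: `L_max < x_c sin(π/8)`) never eats more of
  either mode than a `λ`-multiple of the BIG transform `G_{5/8}` — decorrelation of `L_γ` from the far winding in
  its weakest usable form (domination by `G_{5/8}`, not by the small `G_{11/8}`).
* (F) `stub_dressedFlattening` — `DressedFlattening` (L–XL; OPEN, same mechanism as the crux `ArrivalFlattening`):
  `∀ ε > 0 ∃ R`, at depth `R` (and `v ∉ a`) `‖D_{11/8}‖ ≤ ε‖G_{5/8}‖` — the dressed spin-11/8 transform flattens in
  the bulk like the undressed one (winding spread kills the 11/8-mode of the `L_γ`-reweighted arrival law too).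

Composition `DressingTransfer_of : (A) → (S) → (D) → (F) → DressingTransfer` (kernel-checked, sorry-free), USING
BOTH antecedents of the crux: (K) with `k = max(k_S, (β_T + √3λ)/(α_T − √3λ)) < 1` — at `v ∈ a` by (S); at `v ∉ a`
by (I1) + (D): `‖ΣF‖ ≥ (α_T − √3λ)‖G_{5/8}‖`, and (I2) + (FM: `‖G_{11/8}‖ ≤ ‖G_{5/8}‖`, `5/8 ≤ 11/8` in `[0,3/2]`)
+ (D): `‖B‖ ≤ (β_T + √3λ)‖G_{5/8}‖`; `k < 1 ⟺ 2√3λ < α_T − β_T = 2√3·x_c sin(π/8)` (`cos 5π/24 − cos 11π/24 =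
√3 sin π/8`).  (M): at depth `R = max(R_WCLT(ε'), R_F(ε'), 2)` a vertex is not on `a` (face centres of adjacent
hexagons are within `2`: `dist_triMeshPoint_hexCenter_le`), and (I2) + (WCLT) + (F) give `‖B‖ ≤ (β_T + √3)ε'‖G_{5/8}‖
≤ ε(α_T − √3λ)‖G_{5/8}‖ ≤ ε‖ΣF‖` for `ε' = ε(α_T − √3λ)/(β_T + √3 + 1)`.

Negatives / disproof honoured: no `Disproof.lean` exists for this crux (`ledger crux ls`: no workfiles before this
one); `ledger negatives --problem CriticalPhenomena`: no entry concerns port modes, winding transforms or loop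
generating functions (the SAW entries are the all-`δ` tightness stmt-0772, the un-pinned `HexObservableLimit`
stmt-5420 and `RetrievalStability` of SAWPhaseRetrieval) — no stub asserts tightness, a phase law, or an observable
limit.  No stub restates (K), (M), (FM) or (WCLT): (A) is an identity/inequality between DIFFERENT quantities (full
observable modes vs. first-arrival transforms and their dressings), (S) is the `v ∈ a` corner only, (D)/(F) speak of
the dressed transforms `D_s`, which occur in no route item.
-/

noncomputable section

open Literature.Probability.LatticeModels
open Literature.Probability.RandomPlanarGeometry

namespace Summit.CriticalPhenomena.SAWScalingLimit.Cruxes.DressingTransfer.Birth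

/-! ## 1. Local vocabulary over tree declarations (first-arrival transforms, dressing, port modes, kernel constants) -/

/-- **First-arrival spin transform** `G_s(v) = Σ_{i=0,1,2} F_{Λ∖v}(a, {v,wᵢ}; x_c, s)`: the spin-`s` transform of the
winding law of the walks of `Λ.erase v` from `a` to the three ports of `v` — verbatim the quantity whose modulus
`SpinMonotone` declares antitone in `s` and whose `s = 11/8` vs `s = 5/8` values `ArrivalFlattening` compares. -/
def arrivalTransform (Λ : Finset HexVertex) (a : Sym2 HexVertex) (v w₀ w₁ w₂ : HexVertex) (s : ℝ) : ℂ :=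
  SAW.hexParafermionicObservable (Λ.erase v) a SAW.hexCriticalFugacity s s(v, w₀) +
    SAW.hexParafermionicObservable (Λ.erase v) a SAW.hexCriticalFugacity s s(v, w₁) +
    SAW.hexParafermionicObservable (Λ.erase v) a SAW.hexCriticalFugacity s s(v, w₂)

/-- **Returning-loop dressing** `L_γ(w → w') = x_c · Σ_η x_c^{ℓ(η)}` of a first-arrival prefix `γ` (a walk of
`Λ.erase v`), the sum over the self-avoiding walks `η` of `(Λ.erase v) ∖ γ` from the mid-edge `{v,w}` to the
mid-edge `{v,w'}` (the loops by which a walk that entered `v` through `γ`'s port and left through `{v,w}` returns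
to end at `{v,w'}`; the extra factor `x_c` is the vertex `v`).  Verbatim the sum bounded by the route's support item
`LoopDressingBound` (times `x_c`). -/
def loopDressing (Λ : Finset HexVertex) (v : HexVertex) {a z : Sym2 HexVertex}
    (γ : SAW.HexMidEdgeSAW (Λ.erase v) a z) (w w' : HexVertex) : ℝ :=
  SAW.hexCriticalFugacity *
    ∑ η : SAW.HexMidEdgeSAW ((Λ.erase v) \ γ.verts.toFinset) s(v, w) s(v, w'),
      SAW.hexCriticalFugacity ^ η.length

/-- **Loop-dressed first-arrival transform** `D_s(v) = Σ_j Σ_{γ : a → {v,wⱼ} in Λ∖v} e^{-isW(γ)} x_c^{ℓ(γ)} · L_γ`,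
the dressing of a prefix arriving at port `j` being taken between the two other ports (one orientation per port;
the other orientation has the same value by reversal of `η`). -/
def dressedTransform (Λ : Finset HexVertex) (a : Sym2 HexVertex) (v w₀ w₁ w₂ : HexVertex) (s : ℝ) : ℂ :=
  (∑ γ : SAW.HexMidEdgeSAW (Λ.erase v) a s(v, w₀),
      γ.weight SAW.hexCriticalFugacity s * (loopDressing Λ v γ w₁ w₂ : ℂ)) +
    (∑ γ : SAW.HexMidEdgeSAW (Λ.erase v) a s(v, w₁),
      γ.weight SAW.hexCriticalFugacity s * (loopDressing Λ v γ w₂ w₀ : ℂ)) +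
    (∑ γ : SAW.HexMidEdgeSAW (Λ.erase v) a s(v, w₂),
      γ.weight SAW.hexCriticalFugacity s * (loopDressing Λ v γ w₀ w₁ : ℂ))

/-- **Trivial mode** `ΣF = F{v,w₀} + F{v,w₁} + F{v,w₂}` of the full observable `F = F_Λ(a, ·; x_c, 5/8)` at `v`
(the right-hand side of (K)/(M), literally). -/
def trivialMode (Λ : Finset HexVertex) (a : Sym2 HexVertex) (v w₀ w₁ w₂ : HexVertex) : ℂ :=
  SAW.hexParafermionicObservable Λ a SAW.hexCriticalFugacity (5 / 8) s(v, w₀) +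
    SAW.hexParafermionicObservable Λ a SAW.hexCriticalFugacity (5 / 8) s(v, w₁) +
    SAW.hexParafermionicObservable Λ a SAW.hexCriticalFugacity (5 / 8) s(v, w₂)

/-- **Beltrami mode** `B = F{v,w₀} + ωF{v,w₁} + ω²F{v,w₂}`, `ω = e^{2πi/3}`, of the full observable at `v` (the
left-hand side of (K)/(M), literally; it vanishes for one orientation of the labelling by DCS Lemma 1). -/
def beltramiMode (Λ : Finset HexVertex) (a : Sym2 HexVertex) (v w₀ w₁ w₂ : HexVertex) : ℂ :=
  SAW.hexParafermionicObservable Λ a SAW.hexCriticalFugacity (5 / 8) s(v, w₀) +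
    Complex.exp (2 * Real.pi * Complex.I / 3) *
      SAW.hexParafermionicObservable Λ a SAW.hexCriticalFugacity (5 / 8) s(v, w₁) +
    Complex.exp (2 * Real.pi * Complex.I / 3) ^ 2 *
      SAW.hexParafermionicObservable Λ a SAW.hexCriticalFugacity (5 / 8) s(v, w₂)

/-- `α_T = 1 + 2x_c cos(5π/24) = 1.8587…`: the trivial-mode kernel of "stop or step through `v`" at spin `5/8`
(`1 + x_c e^{-i(5/8)π/3} + x_c e^{+i(5/8)π/3}`). -/
def alphaT : ℝ := 1 + 2 * SAW.hexCriticalFugacity * Real.cos (5 * Real.pi / 24)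

/-- `β_T = 1 + 2x_c cos(11π/24) = 1.1413…`: the Beltrami-mode kernel of "stop or step through `v`"
(`2π/3 − 5π/24 = 11π/24`). -/
def betaT : ℝ := 1 + 2 * SAW.hexCriticalFugacity * Real.cos (11 * Real.pi / 24)

/-! ## 2. The four statements of the line -/

/-- **(A) Mode identities** (`ModeIdentities`): for a simply connected `Λ`, a boundary mid-edge `a`, a vertex
`v ∈ Λ` NOT on `a` and its three ports, (I1) `ΣF = α_T G_{5/8} − √3 D_{5/8}` exactly and (I2)
`‖B‖ ≤ ‖β_T G_{11/8} + √3 D_{11/8}‖` — DCS's pair/triple grouping summed against the trivial and the two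
non-trivial `ℤ/3`-characters of the ports (loop windings `±4π/3`: `2cos(150°) = −√3`, `2cos(30°) = √3`; one-step
windings `±π/3`: `2cos 37.5°`, `2cos 82.5°`; the DCS character gives `0`). -/
def ModeIdentities : Prop :=
  ∀ (Λ : Finset HexVertex), SAW.hexDomainSimplyConnected Λ → ∀ a ∈ SAW.hexDomainBoundary Λ, ∀ v ∈ Λ, v ∉ a →
    ∀ w₀ w₁ w₂ : HexVertex, hexGraph.Adj v w₀ → hexGraph.Adj v w₁ → hexGraph.Adj v w₂ →
      w₀ ≠ w₁ → w₁ ≠ w₂ → w₀ ≠ w₂ →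
        trivialMode Λ a v w₀ w₁ w₂ =
            (alphaT : ℂ) * arrivalTransform Λ a v w₀ w₁ w₂ (5 / 8) -
              (Real.sqrt 3 : ℂ) * dressedTransform Λ a v w₀ w₁ w₂ (5 / 8) ∧
          ‖beltramiMode Λ a v w₀ w₁ w₂‖ ≤
            ‖(betaT : ℂ) * arrivalTransform Λ a v w₀ w₁ w₂ (11 / 8) +
              (Real.sqrt 3 : ℂ) * dressedTransform Λ a v w₀ w₁ w₂ (11 / 8)‖

/-- **(S) No fold at the source vertex** (`SourceNoFold`): there is `k < 1` such that at the vertex `v ∈ Λ` lying ON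
the boundary mid-edge `a` (where the first-arrival transforms vanish identically and (FM)/(WCLT) are vacuous) the
Beltrami mode is at most `k` times the trivial mode, uniformly over simply connected `Λ`.  Equivalent, by the exact
source law `ΣF = α_T − √3 x_c Z`, `‖B‖ ∈ {0, β_T + √3 x_c Z}`, to `SAWDevelopingMap.SourceLoopBound`
(stmt-CriticalPhenomena-8300: the critical generating function `Z` of loops of `Λ∖v` between the two inner ports is
`≤ c < sin(π/8)`). -/
def SourceNoFold : Prop :=
  ∃ k : ℝ, k < 1 ∧ ∀ (Λ : Finset HexVertex), SAW.hexDomainSimplyConnected Λ → ∀ a ∈ SAW.hexDomainBoundary Λ,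
    ∀ v ∈ Λ, v ∈ a → ∀ w₀ w₁ w₂ : HexVertex, hexGraph.Adj v w₀ → hexGraph.Adj v w₁ → hexGraph.Adj v w₂ →
      w₀ ≠ w₁ → w₁ ≠ w₂ → w₀ ≠ w₂ →
        ‖beltramiMode Λ a v w₀ w₁ w₂‖ ≤ k * ‖trivialMode Λ a v w₀ w₁ w₂‖

/-- **(D) Dressing domination** (`DressingDomination`): some `0 ≤ λ < x_c sin(π/8)` (the single-class fold
threshold for `L_γ`) bounds BOTH dressed transforms by the big undressed one, `‖D_{5/8}‖ ≤ λ‖G_{5/8}‖` and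
`‖D_{11/8}‖ ≤ λ‖G_{5/8}‖`, uniformly over simply connected `Λ`, boundary `a`, `v ∉ a` and its ports — the
"local/global decorrelation of the dressing `L_γ` from the far winding" of the crux text in the weakest form the
assembly uses (with `L_γ ≡ L` constant it is `LoopDressingBound`; the content is that coherent cancellation in
`G_{5/8}` is never undone by the `L_γ`-reweighting). -/
def DressingDomination : Prop :=
  ∃ lam : ℝ, 0 ≤ lam ∧ lam < SAW.hexCriticalFugacity * Real.sin (Real.pi / 8) ∧
    ∀ (Λ : Finset HexVertex), SAW.hexDomainSimplyConnected Λ → ∀ a ∈ SAW.hexDomainBoundary Λ, ∀ v ∈ Λ, v ∉ a →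
      ∀ w₀ w₁ w₂ : HexVertex, hexGraph.Adj v w₀ → hexGraph.Adj v w₁ → hexGraph.Adj v w₂ →
        w₀ ≠ w₁ → w₁ ≠ w₂ → w₀ ≠ w₂ →
          ‖dressedTransform Λ a v w₀ w₁ w₂ (5 / 8)‖ ≤ lam * ‖arrivalTransform Λ a v w₀ w₁ w₂ (5 / 8)‖ ∧
            ‖dressedTransform Λ a v w₀ w₁ w₂ (11 / 8)‖ ≤ lam * ‖arrivalTransform Λ a v w₀ w₁ w₂ (5 / 8)‖

/-- **(F) Dressed flattening** (`DressedFlattening`): for every `ε > 0` there is `R` such that at every vertex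
`v ∉ a` whose Euclidean `R`-ball of vertices lies in `Λ` the dressed spin-`11/8` transform is `ε`-small against the
undressed spin-`5/8` transform, `‖D_{11/8}‖ ≤ ε‖G_{5/8}‖` — the `L_γ`-reweighted arrival law flattens in the bulk
like the arrival law itself (`ArrivalFlattening`), by the same winding spread. -/
def DressedFlattening : Prop :=
  ∀ ε : ℝ, 0 < ε → ∃ R : ℝ, ∀ (Λ : Finset HexVertex), SAW.hexDomainSimplyConnected Λ →
    ∀ a ∈ SAW.hexDomainBoundary Λ, ∀ v ∈ Λ, v ∉ a →
      (∀ w : HexVertex, dist (hexCenter w) (hexCenter v) ≤ R → w ∈ Λ) →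
        ∀ w₀ w₁ w₂ : HexVertex, hexGraph.Adj v w₀ → hexGraph.Adj v w₁ → hexGraph.Adj v w₂ →
          w₀ ≠ w₁ → w₁ ≠ w₂ → w₀ ≠ w₂ →
            ‖dressedTransform Λ a v w₀ w₁ w₂ (11 / 8)‖ ≤ ε * ‖arrivalTransform Λ a v w₀ w₁ w₂ (5 / 8)‖

/-! ### Name-keyed aliases of the four statements — the hypotheses of `DressingTransfer_of`

The skeleton audit (`#h21_check_skeleton`) admits a hypothesis of the skeleton theorem only if its head constant is a
registered obligation or is NAMED like a declared stub; `__Registered.stub_X` is the statement of `stub_X` under that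
name (device of `Cruxes/ModulusUniversality/Lines/birth.lean`).  Each alias is definitionally its statement. -/
namespace __Registered

/-- Alias of `ModeIdentities` keyed by the registered stub name. -/
abbrev stub_modeIdentities : Prop := ModeIdentities
/-- Alias of `SourceNoFold` keyed by the registered stub name. -/
abbrev stub_sourceNoFold : Prop := SourceNoFold
/-- Alias of `DressingDomination` keyed by the registered stub name. -/
abbrev stub_dressingDomination : Prop := DressingDomination
/-- Alias of `DressedFlattening` keyed by the registered stub name. -/
abbrev stub_dressedFlattening : Prop := DressedFlattening

end __Registered

/-! ## 3. Registered stubs (`sorry` lives only here; statements LITERAL over §1 and the tree) -/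

/-- **STUB A (M–L; PROVABLE NOW) — `ModeIdentities`, literal.**  Why true: the bijection "walk of `Λ` from `a` to a
port of `v`" ↔ "(first arrival `γ` in `Λ.erase v`) + (nothing | one step through `v` | step through `v` and a loop `η`
of `(Λ.erase v)∖γ` between the two other ports)" (needs `v ∉ a`: then `γ` is a genuine nonempty prefix and no edge is
reused), `ℓ` and `e^{-iσW}` multiplicative along it (`HexMidEdgeSAW.weight`; the polyline through `mid{v,wⱼ}` is
straight, so `W` adds up), one-step turn `±π/3`, loop winding `±4π/3` (turning number `±2π` of the simple closed
lattice polygon `v, η, v`, whose third edge at `v` points outside because `a` lies outside — simply connectedness),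
reversal `η ↦ η⁻¹` equating the two loop orientations, and `e^{-3iW(γ)}` constant over all first arrivals (arrival
headings differ by multiples of `2π/3`), which turns the `e^{-i(13/8)W}` reading of the non-trivial character into the
conjugate spin-`11/8` reading; the DCS character vanishes (tree fact `SAW.DuminilCopinSmirnov2012_lemma1`, same
grouping).  Why it might fail: only by a bookkeeping slip in the constants (guarded: `α_T`, `β_T`, `∓√3` re-derived
twice, numerically `α_T = 1.8587`, `β_T = 1.1413` as in the route header and `SAWDevelopingMap.SourceLoopBound`'s
docstring); the hardest formal step is the discrete Umlaufsatz for hexagonal lattice polygons. -/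
theorem stub_modeIdentities :
    ∀ (Λ : Finset HexVertex), SAW.hexDomainSimplyConnected Λ → ∀ a ∈ SAW.hexDomainBoundary Λ, ∀ v ∈ Λ, v ∉ a →
      ∀ w₀ w₁ w₂ : HexVertex, hexGraph.Adj v w₀ → hexGraph.Adj v w₁ → hexGraph.Adj v w₂ →
        w₀ ≠ w₁ → w₁ ≠ w₂ → w₀ ≠ w₂ →
          trivialMode Λ a v w₀ w₁ w₂ =
              (alphaT : ℂ) * arrivalTransform Λ a v w₀ w₁ w₂ (5 / 8) -
                (Real.sqrt 3 : ℂ) * dressedTransform Λ a v w₀ w₁ w₂ (5 / 8) ∧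
            ‖beltramiMode Λ a v w₀ w₁ w₂‖ ≤
              ‖(betaT : ℂ) * arrivalTransform Λ a v w₀ w₁ w₂ (11 / 8) +
                (Real.sqrt 3 : ℂ) * dressedTransform Λ a v w₀ w₁ w₂ (11 / 8)‖ := by
  sorry

/-- **STUB S (L; open, wide numerical margin) — `SourceNoFold`, literal.**  Why plausibly true: at the source the
triple of port values is `(1, x_c e^{∓iπσ/3} + L e^{∓5iπ/6}·…, c.c.)` with `L = x_c Z`, `Z` the critical generating
function of loops of `Λ∖v` between the two inner ports, so `‖B‖/‖ΣF‖ = (β_T + √3L)/(α_T − √3L)` (or `0`) and the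
claim is `Z ≤ c < sin(π/8) = 0.3827` uniformly — observed `Z ≤ 0.081` (route SAWDevelopingMap data, domains ≤ 97
vertices), smallest loop `x_c^5 = 0.046`, refuter tail estimate `≈ 0.16`; it is the sibling support item
`SAWDevelopingMap.SourceLoopBound` (stmt-CriticalPhenomena-8300) read through the exact source law.  Why it might
fail: uniformity over ALL simply connected `Λ` (fjords, pocket mouths at the source); the only rigorous bound from the
DCS sum rule in `Λ∖v` is `Z ≲ 0.92`. -/
theorem stub_sourceNoFold :
    ∃ k : ℝ, k < 1 ∧ ∀ (Λ : Finset HexVertex), SAW.hexDomainSimplyConnected Λ → ∀ a ∈ SAW.hexDomainBoundary Λ,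
      ∀ v ∈ Λ, v ∈ a → ∀ w₀ w₁ w₂ : HexVertex, hexGraph.Adj v w₀ → hexGraph.Adj v w₁ → hexGraph.Adj v w₂ →
        w₀ ≠ w₁ → w₁ ≠ w₂ → w₀ ≠ w₂ →
          ‖beltramiMode Λ a v w₀ w₁ w₂‖ ≤ k * ‖trivialMode Λ a v w₀ w₁ w₂‖ := by
  sorry

/-- **STUB D (L–XL; OPEN — the load-bearing one) — `DressingDomination`, literal.**  Why plausibly true: `L_γ ∈
[0, L_max]` with `L_max = x_c · sup Z_γ < x_c sin(π/8) = 0.207` (support `LoopDressingBound`; observed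
`x_c · 0.16 ≈ 0.087`), and `L_γ` depends on `γ` essentially through the local geometry of its last turns near `v`,
which asymptotically decouples from the far winding `W(γ)`: `D_s ≈ L̄ · G_s` with `|L̄| ≤ L_max`, leaving a margin of
a factor `≈ 2.4` for the fluctuation term; at small depth the phases of the arrivals are aligned and `‖D_s‖ ≤
L_max Σ x_c^ℓ ≈ L_max‖G_{5/8}‖`.  Why it might fail (the crux's own risk, verbatim): `L_γ` correlates with
`W(γ) mod 2π` through which ports `γ` blocks; in the crossover regime (winding spread ≈ one `120°` class) a small
`G_{5/8}` with coherent dressing could leave `‖D_{5/8}‖ > x_c sin(π/8) ‖G_{5/8}‖` while (FM) holds — exactly the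
fold (`¬NoFoldBound`) witness the route's kill criteria name.  Pointwise domination by `G_{5/8}` (not by the small
`G_{11/8}`) is deliberate: zeros of `G_{11/8}` are harmless. -/
theorem stub_dressingDomination :
    ∃ lam : ℝ, 0 ≤ lam ∧ lam < SAW.hexCriticalFugacity * Real.sin (Real.pi / 8) ∧
      ∀ (Λ : Finset HexVertex), SAW.hexDomainSimplyConnected Λ → ∀ a ∈ SAW.hexDomainBoundary Λ, ∀ v ∈ Λ, v ∉ a →
        ∀ w₀ w₁ w₂ : HexVertex, hexGraph.Adj v w₀ → hexGraph.Adj v w₁ → hexGraph.Adj v w₂ →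
          w₀ ≠ w₁ → w₁ ≠ w₂ → w₀ ≠ w₂ →
            ‖dressedTransform Λ a v w₀ w₁ w₂ (5 / 8)‖ ≤ lam * ‖arrivalTransform Λ a v w₀ w₁ w₂ (5 / 8)‖ ∧
              ‖dressedTransform Λ a v w₀ w₁ w₂ (11 / 8)‖ ≤ lam * ‖arrivalTransform Λ a v w₀ w₁ w₂ (5 / 8)‖ := by
  sorry

/-- **STUB F (L–XL; OPEN, rides with `ArrivalFlattening`) — `DressedFlattening`, literal.**  Why plausibly true: the
dressed transform is the spin-`11/8` transform of the arrival law reweighted by the bounded non-negative local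
functional `L_γ ≤ L_max`; the winding central limit behaviour that makes `G_{11/8} = o(G_{5/8})` at depth `R → ∞`
(Gaussian prediction `exp(−0.75 Var W_v)`, `Var W_v ≍ c log R`; DuplantierSaleur1988, Schramm2000 §7) acts on the
reweighted law identically once `L_γ` decouples from the far winding.  Why it might fail: as for `ArrivalFlattening`
(no RSW/FKG for the critical SAW; pointwise and uniform over fjords at fixed depth) plus the local/global
decorrelation of `L_γ` — a ratio of two decaying quantities. -/
theorem stub_dressedFlattening :
    ∀ ε : ℝ, 0 < ε → ∃ R : ℝ, ∀ (Λ : Finset HexVertex), SAW.hexDomainSimplyConnected Λ →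
      ∀ a ∈ SAW.hexDomainBoundary Λ, ∀ v ∈ Λ, v ∉ a →
        (∀ w : HexVertex, dist (hexCenter w) (hexCenter v) ≤ R → w ∈ Λ) →
          ∀ w₀ w₁ w₂ : HexVertex, hexGraph.Adj v w₀ → hexGraph.Adj v w₁ → hexGraph.Adj v w₂ →
            w₀ ≠ w₁ → w₁ ≠ w₂ → w₀ ≠ w₂ →
              ‖dressedTransform Λ a v w₀ w₁ w₂ (11 / 8)‖ ≤ ε * ‖arrivalTransform Λ a v w₀ w₁ w₂ (5 / 8)‖ := by
  sorry

/-! ## 4. Sorry-free glue: constants, geometry, and the skeleton theorem -/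

/-- `0 < x_c < 1`, `0 < sin(π/8) < 1/2`, `0 < √3 < 2` packaged. -/
theorem consts_bounds :
    0 < SAW.hexCriticalFugacity ∧ SAW.hexCriticalFugacity < 1 ∧ 0 < Real.sin (Real.pi / 8) ∧
      Real.sin (Real.pi / 8) < 1 / 2 ∧ 0 < Real.sqrt 3 ∧ Real.sqrt 3 < 2 := by
  obtain ⟨hx0, hx1⟩ := SAW.hexCriticalFugacity_pos_lt_one
  refine ⟨hx0, hx1, ?_, ?_, ?_, ?_⟩
  · exact Real.sin_pos_of_pos_of_lt_pi (by positivity) (by linarith [Real.pi_pos])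
  · rw [← Real.sin_pi_div_six]
    exact Real.sin_lt_sin_of_lt_of_le_pi_div_two (by linarith [Real.pi_pos]) (by linarith [Real.pi_pos])
      (by linarith [Real.pi_pos])
  · exact Real.sqrt_pos.2 (by norm_num)
  · exact (Real.sqrt_lt' (by norm_num)).2 (by norm_num)

/-- `cos(5π/24) − cos(11π/24) = √3 sin(π/8)` (so `α_T − β_T = 2√3 x_c sin(π/8)`). -/
theorem cos_sub_cos_ports :
    Real.cos (5 * Real.pi / 24) - Real.cos (11 * Real.pi / 24) = Real.sqrt 3 * Real.sin (Real.pi / 8) := by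
  rw [Real.cos_sub_cos]
  have e1 : (5 * Real.pi / 24 + 11 * Real.pi / 24) / 2 = Real.pi / 3 := by ring
  have e2 : (5 * Real.pi / 24 - 11 * Real.pi / 24) / 2 = -(Real.pi / 8) := by ring
  rw [e1, e2, Real.sin_neg, Real.sin_pi_div_three]
  ring

/-- `1 < α_T` and `0 ≤ β_T`. -/
theorem alphaT_betaT_bounds : 1 < alphaT ∧ 0 ≤ betaT := by
  obtain ⟨hx0, -, -⟩ := consts_bounds
  have hc5 : 0 < Real.cos (5 * Real.pi / 24) :=
    Real.cos_pos_of_mem_Ioo ⟨by linarith [Real.pi_pos], by linarith [Real.pi_pos]⟩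
  have hc11 : 0 ≤ Real.cos (11 * Real.pi / 24) :=
    Real.cos_nonneg_of_mem_Icc ⟨by linarith [Real.pi_pos], by linarith [Real.pi_pos]⟩
  refine ⟨?_, ?_⟩
  · have : 0 < 2 * SAW.hexCriticalFugacity * Real.cos (5 * Real.pi / 24) := by positivity
    simp only [alphaT]; linarith
  · have : 0 ≤ 2 * SAW.hexCriticalFugacity * Real.cos (11 * Real.pi / 24) := by positivity
    simp only [betaT]; linarith

/-- For `0 ≤ λ < x_c sin(π/8)`: `0 < α_T − √3λ`, and the no-fold constant `k_D = (β_T + √3λ)/(α_T − √3λ)` lies in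
`[0, 1)`. -/
theorem kD_bounds {lam : ℝ} (h0 : 0 ≤ lam) (hlam : lam < SAW.hexCriticalFugacity * Real.sin (Real.pi / 8)) :
    0 < alphaT - Real.sqrt 3 * lam ∧ 0 ≤ (betaT + Real.sqrt 3 * lam) / (alphaT - Real.sqrt 3 * lam) ∧
      (betaT + Real.sqrt 3 * lam) / (alphaT - Real.sqrt 3 * lam) < 1 := by
  obtain ⟨hx0, hx1, hs0, hs1, h30, h32⟩ := consts_bounds
  obtain ⟨hα, hβ⟩ := alphaT_betaT_bounds
  have e1 : SAW.hexCriticalFugacity * Real.sin (Real.pi / 8) < 1 / 2 := by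
    nlinarith [mul_pos hs0 (sub_pos.2 hx1)]
  have e2 : Real.sqrt 3 * lam ≤ 2 * lam := mul_le_mul_of_nonneg_right h32.le h0
  have hpos : 0 < alphaT - Real.sqrt 3 * lam := by linarith
  have h3l : Real.sqrt 3 * lam < Real.sqrt 3 * (SAW.hexCriticalFugacity * Real.sin (Real.pi / 8)) :=
    mul_lt_mul_of_pos_left hlam h30
  have hdiff : alphaT - betaT = 2 * (Real.sqrt 3 * (SAW.hexCriticalFugacity * Real.sin (Real.pi / 8))) := by
    simp only [alphaT, betaT]
    linear_combination (2 * SAW.hexCriticalFugacity) * cos_sub_cos_ports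
  have hlt : betaT + Real.sqrt 3 * lam < alphaT - Real.sqrt 3 * lam := by linarith
  refine ⟨hpos, div_nonneg (by positivity) hpos.le, (div_lt_one hpos).2 hlt⟩

/-- **A vertex at depth `≥ 2` is not on the boundary mid-edge `a`**: if `v ∈ a = {u, v}` with `u ∉ Λ` then the
face centres of the adjacent hexagons `u`, `v` are within `2` (each is within `1` of a shared vertex of `𝕋`,
`dist_triMeshPoint_hexCenter_le`), so the `R`-ball hypothesis with `R ≥ 2` would force `u ∈ Λ`. -/
theorem not_mem_of_deep {Λ : Finset HexVertex} {a : Sym2 HexVertex} {v : HexVertex} {R : ℝ}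
    (ha : a ∈ SAW.hexDomainBoundary Λ) (hv : v ∈ Λ)
    (hdeep : ∀ w : HexVertex, dist (hexCenter w) (hexCenter v) ≤ R → w ∈ Λ) (hR : 2 ≤ R) : v ∉ a := by
  intro hva
  obtain ⟨he, u, u', rfl, hu', hu⟩ := ha
  have hvu' : v = u' := by
    rcases Sym2.mem_iff.1 hva with h | h
    · exact absurd (h ▸ hv) hu
    · exact h
  subst hvu'
  have hadj : hexGraph.Adj u v := (SimpleGraph.mem_edgeSet hexGraph).1 he
  have hcard := ((hexGraph_adj_iff u v).1 hadj).2
  obtain ⟨p, hp⟩ := Finset.card_pos.1 (by rw [hcard]; norm_num)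
  rw [Finset.mem_inter] at hp
  have h1 := Literature.Probability.Percolation.dist_triMeshPoint_hexCenter_le hp.1 1
  have h2 := Literature.Probability.Percolation.dist_triMeshPoint_hexCenter_le hp.2 1
  simp only [abs_one, Complex.ofReal_one, one_mul] at h1 h2
  have hdist : dist (hexCenter u) (hexCenter v) ≤ 2 :=
    calc dist (hexCenter u) (hexCenter v)
        ≤ dist (hexCenter u) (triMeshPoint 1 p) + dist (triMeshPoint 1 p) (hexCenter v) := dist_triangle _ _ _
      _ ≤ 1 + 1 := add_le_add (by rwa [dist_comm] at h1) h2
      _ = 2 := by norm_num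
  exact hu (hdeep u (hdist.trans hR))

/-- Norm bookkeeping behind (K) and (M): from the identity (I1) and the inequality (I2), reverse/forward triangle
inequalities give `α_T‖G₅‖ − √3‖D₅‖ ≤ ‖ΣF‖` and `‖B‖ ≤ β_T‖G₁₁‖ + √3‖D₁₁‖`. -/
theorem mode_norm_bounds {T B G5 G11 D5 D11 : ℂ}
    (hT : T = (alphaT : ℂ) * G5 - (Real.sqrt 3 : ℂ) * D5)
    (hB : ‖B‖ ≤ ‖(betaT : ℂ) * G11 + (Real.sqrt 3 : ℂ) * D11‖) :
    alphaT * ‖G5‖ - Real.sqrt 3 * ‖D5‖ ≤ ‖T‖ ∧ ‖B‖ ≤ betaT * ‖G11‖ + Real.sqrt 3 * ‖D11‖ := by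
  obtain ⟨hα, hβ⟩ := alphaT_betaT_bounds
  have h3 : 0 ≤ Real.sqrt 3 := Real.sqrt_nonneg 3
  constructor
  · have h := norm_sub_norm_le ((alphaT : ℂ) * G5) ((Real.sqrt 3 : ℂ) * D5)
    rw [← hT, norm_mul, norm_mul, Complex.norm_real, Complex.norm_real, Real.norm_of_nonneg (by linarith),
      Real.norm_of_nonneg h3] at h
    exact h
  · refine hB.trans ((norm_add_le _ _).trans (le_of_eq ?_))
    rw [norm_mul, norm_mul, Complex.norm_real, Complex.norm_real, Real.norm_of_nonneg hβ,
      Real.norm_of_nonneg h3]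

/-- **`DressingTransfer_of`: ModeIdentities → SourceNoFold → DressingDomination → DressedFlattening →
`DressingTransfer`** — the four registered stubs imply the crux BY NAME (kernel-checked, no `sorry` here), and both
antecedents (FM) `SpinMonotone` and (WCLT) `ArrivalFlattening` of the crux are consumed.  (K): `k = max(k_S, k_D)`,
`k_D = (β_T + √3λ)/(α_T − √3λ)`; at `v ∈ a` by (S); at `v ∉ a`: `‖B‖ ≤ β_T‖G₁₁‖ + √3‖D₁₁‖ ≤ (β_T + √3λ)‖G₅‖`
((I2), FM at `5/8 ≤ 11/8`, (D)) and `(α_T − √3λ)‖G₅‖ ≤ ‖ΣF‖` ((I1), (D)).  (M): `ε' = ε(α_T − √3λ)/(β_T + √3 + 1)`,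
`R = max (max R_WCLT(ε') R_F(ε')) 2`; at depth `R` the vertex is off `a` (`not_mem_of_deep`) and
`‖B‖ ≤ β_T ε'‖G₅‖ + √3 ε'‖G₅‖ ≤ ε(α_T − √3λ)‖G₅‖ ≤ ε‖ΣF‖`. -/
theorem DressingTransfer_of (hA : __Registered.stub_modeIdentities) (hS : __Registered.stub_sourceNoFold)
    (hD : __Registered.stub_dressingDomination) (hF : __Registered.stub_dressedFlattening) :
    Summit.CriticalPhenomena.SAWScalingLimit.Theses.SAWSpinMonotone.DressingTransfer := by
  intro hFM hAF
  obtain ⟨kS, hkS, hS⟩ := hS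
  obtain ⟨lam, hlam0, hlam, hD⟩ := hD
  obtain ⟨hpos, hkD0, hkD1⟩ := kD_bounds hlam0 hlam
  obtain ⟨hα, hβ⟩ := alphaT_betaT_bounds
  have h3 : 0 ≤ Real.sqrt 3 := Real.sqrt_nonneg 3
  have h5 : (5 / 8 : ℝ) ∈ Set.Icc (0 : ℝ) (3 / 2) := ⟨by norm_num, by norm_num⟩
  have h11 : (11 / 8 : ℝ) ∈ Set.Icc (0 : ℝ) (3 / 2) := ⟨by norm_num, by norm_num⟩
  set kD : ℝ := (betaT + Real.sqrt 3 * lam) / (alphaT - Real.sqrt 3 * lam) with hkD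
  refine ⟨⟨max kS kD, max_lt hkS hkD1, ?_⟩, ?_⟩
  · -- (K) the uniform no-fold bound
    intro Λ hΛ a ha v hv w₀ w₁ w₂ hw₀ hw₁ hw₂ h01 h12 h02
    show ‖beltramiMode Λ a v w₀ w₁ w₂‖ ≤ max kS kD * ‖trivialMode Λ a v w₀ w₁ w₂‖
    by_cases hva : v ∈ a
    · exact (hS Λ hΛ a ha v hv hva w₀ w₁ w₂ hw₀ hw₁ hw₂ h01 h12 h02).trans
        (mul_le_mul_of_nonneg_right (le_max_left _ _) (norm_nonneg _))
    · obtain ⟨hI1, hI2⟩ := hA Λ hΛ a ha v hv hva w₀ w₁ w₂ hw₀ hw₁ hw₂ h01 h12 h02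
      obtain ⟨hT, hB⟩ := mode_norm_bounds hI1 hI2
      obtain ⟨hd5, hd11⟩ := hD Λ hΛ a ha v hv hva w₀ w₁ w₂ hw₀ hw₁ hw₂ h01 h12 h02
      have hg : ‖arrivalTransform Λ a v w₀ w₁ w₂ (11 / 8)‖ ≤ ‖arrivalTransform Λ a v w₀ w₁ w₂ (5 / 8)‖ :=
        hFM Λ hΛ a ha v hv w₀ w₁ w₂ hw₀ hw₁ hw₂ h01 h12 h02 h5 h11 (by norm_num)
      set g := ‖arrivalTransform Λ a v w₀ w₁ w₂ (5 / 8)‖ with hg_def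
      have hg0 : 0 ≤ g := norm_nonneg _
      have hb : ‖beltramiMode Λ a v w₀ w₁ w₂‖ ≤ (betaT + Real.sqrt 3 * lam) * g := by
        have e1 := mul_le_mul_of_nonneg_left hg hβ
        have e2 := mul_le_mul_of_nonneg_left hd11 h3
        nlinarith [e1, e2]
      have ht : (alphaT - Real.sqrt 3 * lam) * g ≤ ‖trivialMode Λ a v w₀ w₁ w₂‖ := by
        have e3 := mul_le_mul_of_nonneg_left hd5 h3
        nlinarith [e3]
      have hgt : g ≤ ‖trivialMode Λ a v w₀ w₁ w₂‖ / (alphaT - Real.sqrt 3 * lam) := by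
        rw [le_div_iff₀ hpos]; linarith
      calc ‖beltramiMode Λ a v w₀ w₁ w₂‖ ≤ (betaT + Real.sqrt 3 * lam) * g := hb
        _ ≤ (betaT + Real.sqrt 3 * lam) * (‖trivialMode Λ a v w₀ w₁ w₂‖ / (alphaT - Real.sqrt 3 * lam)) :=
            mul_le_mul_of_nonneg_left hgt (by positivity)
        _ = kD * ‖trivialMode Λ a v w₀ w₁ w₂‖ := by rw [hkD]; ring
        _ ≤ max kS kD * ‖trivialMode Λ a v w₀ w₁ w₂‖ :=
            mul_le_mul_of_nonneg_right (le_max_right _ _) (norm_nonneg _)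
  · -- (M) interior flattening
    intro ε hε
    set M₀ : ℝ := betaT + Real.sqrt 3 + 1 with hM₀
    have hM₀pos : 0 < M₀ := by positivity
    set ε' : ℝ := ε * (alphaT - Real.sqrt 3 * lam) / M₀ with hε'
    have hε'pos : 0 < ε' := by positivity
    have hMε : M₀ * ε' = ε * (alphaT - Real.sqrt 3 * lam) := by
      rw [hε']; field_simp
    obtain ⟨R₁, hR₁⟩ := hAF ε' hε'pos
    obtain ⟨R₂, hR₂⟩ := hF ε' hε'pos
    refine ⟨max (max R₁ R₂) 2, ?_⟩
    intro Λ hΛ a ha v hv hdeep w₀ w₁ w₂ hw₀ hw₁ hw₂ h01 h12 h02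
    show ‖beltramiMode Λ a v w₀ w₁ w₂‖ ≤ ε * ‖trivialMode Λ a v w₀ w₁ w₂‖
    have hdeep₁ : ∀ w : HexVertex, dist (hexCenter w) (hexCenter v) ≤ R₁ → w ∈ Λ :=
      fun w hw => hdeep w (hw.trans ((le_max_left _ _).trans (le_max_left _ _)))
    have hdeep₂ : ∀ w : HexVertex, dist (hexCenter w) (hexCenter v) ≤ R₂ → w ∈ Λ :=
      fun w hw => hdeep w (hw.trans ((le_max_right _ _).trans (le_max_left _ _)))
    have hva : v ∉ a := not_mem_of_deep ha hv hdeep (le_max_right _ _)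
    obtain ⟨hI1, hI2⟩ := hA Λ hΛ a ha v hv hva w₀ w₁ w₂ hw₀ hw₁ hw₂ h01 h12 h02
    obtain ⟨hT, hB⟩ := mode_norm_bounds hI1 hI2
    obtain ⟨hd5, -⟩ := hD Λ hΛ a ha v hv hva w₀ w₁ w₂ hw₀ hw₁ hw₂ h01 h12 h02
    have hg : ‖arrivalTransform Λ a v w₀ w₁ w₂ (11 / 8)‖ ≤ ε' * ‖arrivalTransform Λ a v w₀ w₁ w₂ (5 / 8)‖ :=
      hR₁ Λ hΛ a ha v hv hdeep₁ w₀ w₁ w₂ hw₀ hw₁ hw₂ h01 h12 h02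
    have hd11 : ‖dressedTransform Λ a v w₀ w₁ w₂ (11 / 8)‖ ≤ ε' * ‖arrivalTransform Λ a v w₀ w₁ w₂ (5 / 8)‖ :=
      hR₂ Λ hΛ a ha v hv hva hdeep₂ w₀ w₁ w₂ hw₀ hw₁ hw₂ h01 h12 h02
    set g := ‖arrivalTransform Λ a v w₀ w₁ w₂ (5 / 8)‖ with hg_def
    have hg0 : 0 ≤ g := norm_nonneg _
    have hb : ‖beltramiMode Λ a v w₀ w₁ w₂‖ ≤ (betaT + Real.sqrt 3) * (ε' * g) := by
      have e1 := mul_le_mul_of_nonneg_left hg hβ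
      have e2 := mul_le_mul_of_nonneg_left hd11 h3
      nlinarith [e1, e2]
    have ht : (alphaT - Real.sqrt 3 * lam) * g ≤ ‖trivialMode Λ a v w₀ w₁ w₂‖ := by
      have e3 := mul_le_mul_of_nonneg_left hd5 h3
      nlinarith [e3]
    have hεg : 0 ≤ ε' * g := by positivity
    calc ‖beltramiMode Λ a v w₀ w₁ w₂‖ ≤ (betaT + Real.sqrt 3) * (ε' * g) := hb
      _ ≤ M₀ * (ε' * g) := mul_le_mul_of_nonneg_right (by rw [hM₀]; linarith) hεg
      _ = ε * ((alphaT - Real.sqrt 3 * lam) * g) := by rw [← mul_assoc, hMε]; ring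
      _ ≤ ε * ‖trivialMode Λ a v w₀ w₁ w₂‖ := mul_le_mul_of_nonneg_left ht hε.le

/-- Wiring check (an `example`, so that `DressingTransfer_of` stays the only theorem concluding the crux): the
registered stubs, with their literal types, feed the skeleton theorem — this term becomes the crux proof when the
four `sorry`s above are discharged. -/
example : Summit.CriticalPhenomena.SAWScalingLimit.Theses.SAWSpinMonotone.DressingTransfer :=
  DressingTransfer_of stub_modeIdentities stub_sourceNoFold stub_dressingDomination stub_dressedFlattening

end Summit.CriticalPhenomena.SAWScalingLimit.Cruxes.DressingTransfer.Birth

end
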